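import Summits.Ventures.HSemireg.Pad4TowerFCCoreParitySeam
import Summits.Ventures.HSemireg.Pad4TowerEFreeAnnihilators

/-!
# Venture HSemireg — PAD-4 on 𝔅(μ₄): FACE BALANCE — LEMMA FC-CORE §2 for EVERY weighted 𝔅(μ₄) configuration, all four phases: under
# (A1), for every non-empty proper face `A ⊊ {factors}`, every parity pattern `ρ_A` on `A` and every choice of e-free letters `w_g ∈ {1,u,v,p}`
# on the free factors, the SIGNED-charge-weighted `w`-moment of the face group `G(A, ρ_A)` is LEVEL-BALANCED (`Σ_{E₋} m = Σ_{E₊} m`);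
# presence forms: signs never one-sided (all phases), «every face group met by the support meets BOTH levels» (window phases, (M0)∕(R2))

HONEST FRAMING. Lean index of the computation cell `pub-hsemireg` (S4-PUSH, H2 door PAD-4), typed by the Ventures-side typer
`hodge-lit-semireg-typer-2` (g5; line of record stmt-HodgeConjecture-18881 `Cruxes/BlochSeedDiscOne/Lines/birth.lean` 814a6a70c14e831a,
stub `stub_rung_pad4_seedAt`, screen (H1) = the class condition (A1)). Twelfth file of the KERNEL LEMMA Ψ ⊂ (A1) set; sequel of (J)
`Pad4TowerFCCoreParitySeam` (axis letters, `kbit` = phase parity, `chargeOf` = signed charge) and of `Pad4TowerEFreeAnnihilators` (`rphi`,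
`bphi_eq_cast`). SOURCE SENTENCE (gs-eng-2 g51, LEMMA-FCCORE-gs2g51.md v1.3 §2 LEMMA FACE-BALANCE, stated and machine-checked there for the
two-phase window `𝒜_{1,i}` — 528 + 528 exact moment conditions on D_ML8's (H1) solution and on the seed — with the general-phase form in §5
«each face group G(A, ρ_A) with weights W_Z (−1)^{#{f∈A: k_f ∈ {2,3}}} has vanishing free-factor moments; presence form: on a non-empty
parity face group the sign ε_Z · (−1)^{#…} is NOT constant — stated here, machine check of that extension not yet run»): «For a proper
factor set ∅ ≠ A ⊊ {1,2,3,4} and phases κ_A let G(A, κ_A) := {Z ∈ S : c_f > 0 and k_f = κ_f for all f ∈ A} (letters on the other factors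
arbitrary, charged or not), W_Z := m_Z Π_{f∈A} c_f. If S satisfies (A1)(i) then for every choice of w_g ∈ {1, u, p} on the free factors
Σ_{Z ∈ G(A,κ_A)} ε_Z W_Z Π_{g∉A} φ(x_g)[w_g] = 0 (φ[1] = 1, φ[u] = α_g, φ[p] = α_g² − c_g²). PROOF. Take the words with e∕ē on A … and w_g
on g ∉ A; … the multilinear polynomial Y(t_A) vanishes on the whole grid {±i}^A, hence Y ≡ 0.» THIS FILE PROVES IT IN THE KERNEL FOR ALL OF
𝔅(μ₄) (every phase, every height, every integer multiplicity vector), by the one-line form of that interpolation: per face factor the two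
PARITY SELECTORS `e + ē` and `i(e − ē)` read `2·chargeOf·[kbit = 0]` resp. `2·chargeOf·[kbit = 1]` on every μ₄ letter (and `0` on an
uncharged one), so the rank-one functional «selector of `ρ_f` on `f ∈ A` ⊗ reader of `w_g` on `g ∉ A`» evaluates on a cell to `2^{|A|}` times
its FACE WEIGHT `Π_{f∈A} faceCh_{ρ_f}(Z_f) · Π_{g∉A} rphi(Z_g)[w_g]`, while its support consists of words carrying `e∕ē` on `A ≠ ∅` and an
e-free letter on `Aᶜ ≠ ∅` — e-mixed words other than `eeee`, `ēēēē`, all killed by (A1)(i). The antipodal sign is automatic: `chargeOf =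
Re β − Im β` is `+c` on `c, −ci` and `−c` on `−c, ci` ((J) `kbit_chargeOf_lpt`).

CONTENT (all PROVED; no `sorry`; axioms standard).
* §1 `tfun σ` (rank-one word functional `Σ_w Π_f σ_f[w_f]·T(w)`), **`tfun_chTensor`** (`= Π_f ⟨σ_f, v_f⟩` on a pure tensor), `MConfig.tfun_wch`
  (linearity over a weighted class tensor), **`tfun_eq_zero_of_classScreen`** (a functional reading only `e, ē` on one factor and no `e, ē` on
  another kills every class function passing (A1)(i)); `eWord_apply`.
* §2 `Mu4Pt` (uncharged or axis letter; `mu4Pt_lpt`: every `lpt c k`), selectors `selR = e + ē`, `selI = i·e − i·ē`, `sel b`, reader `dlt l`,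
  the face reading `faceCh b x = [kbit x = b] · chargeOf x`; **`sel_bphi`** (`⟨sel b, φ(x)⟩ = 2·faceCh b x` on μ₄ letters), `dlt_bphi`
  (`⟨δ_l, φ(x)⟩ = rphi x l` for e-free `l`), `sel_dlt_support`.
* §3 `OnFace w f` (letter `e ∕ ē`: the face `A(w)` of a word), `faceFun w ρ`, **`MCell.faceWt w ρ`** (the integer face weight), `faceTwo w = 2^{|A|}`,
  **`MCell.tfun_faceFun`** (functional = `2^{|A|} ·` face weight on μ₄ cells), `faceFun_eq_zero_of_classScreen`, and **FACE BALANCE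
  `MConfig.faceBalance_of_classScreen`**: (A1) ⇒ `Σ_{N ∈ E₋} m_N faceWt(N) = Σ_{P ∈ E₊} m_P faceWt(P)` for every face word with a non-empty
  proper face and every parity pattern (64 face groups × all free-letter moments: (M0) `w_g = 1`, (M1) `u`, (M2) `p`, and mixed).
* §4 presence forms: `balance_signs` (a balance of positively weighted sums forces mixed signs); **`MConfig.faceSigns_of_classScreen`** (all
  phases, multiplicities `> 0`: the face weight is never one-signed against the levels); `PureFace`, `MCell.faceWt_pure`, `MCell.InFace`
  (membership in `G(A, ρ_A)`), `faceCh_ne_zero_iff`, `faceCh_nonneg_win`, `MCell.faceWt_pure_ne_zero_iff`; **`MConfig.faceGroup_bothLevels_win`**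
  ((M0) as printed for `𝒜_{1,i}` = the encoder clause (R2): with window-or-zero letters every face group meeting the support contains an
  N-class iff it contains a P-class); `faceGroup_count` (`8 + 24 + 32 = 64`, `decide`).
* §5 `face_probe` (`decide`: a cell with an `i`-phase letter of charge 2 on the face — `kbit = 1`, `chargeOf = −2` — its face weights).

WHAT IS NOT HERE ∕ NOT IN LEAN. The case `A = {all four factors}` is LEMMA FC-CORE §1b itself ((J): there the functional meets `eeee`, `ēēēē`
and reads μ); `A = ∅` is an e-free row (`Pad4TowerEFreeAnnihilators`). The (H1) LP, the 528-condition machine checks, encoders, SAT verdicts,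
the static game: not here; nothing here is an object or a census row. The frame's identification with `H^{ev}(S⁴)` and of the screen with
PAD4-FIRSTORDER §0's (A1)-target stays the cell's pencil modelling sentence (as for 840 ∕ (F) ∕ (J)). No variety, sheaf, σ, seed or abelian
variety; NOTHING HERE SAYS THAT HC ∕ HC_CM ∕ HC_AV ∕ W₆ ∕ HC_Kum4Type HOLDS OR FAILS. No `instance`, no notation, no named fact, 0 `sorry`.

SOURCES (sha16 ∕ bus): LEMMA-FCCORE-gs2g51.md v1.3 eed5177b5e337200 §2, §4 (R2), §5; (J) `Pad4TowerFCCoreParitySeam.lean` cbe3f9cea9813991;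
(F) `Pad4TowerFCCoreSeam.lean` afb1e6d84449a076 (p603640); `Pad4TowerEFreeAnnihilators.lean` (tree); `Pad4TowerClassScreen.lean` (p591160:
`ClassScreen`, `chTensor`); `Pad4TowerPsiSubA1.lean` (`bphi`, `MCell.ch`, `MConfig.wch`); card `birth-v4.md` v4.16 08c5ff260e40feb3 row W13. -/

namespace Summit.Ventures.HSemireg.Pad4Tower

open Finset

/-! ## §1 Rank-one word functionals: definition, value on a pure tensor, value on a weighted class tensor -/

/-- a RANK-ONE FUNCTIONAL on the word frame: one coefficient vector `σ_f ∈ ℤ[i]⁶` per factor,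
`Λ_σ(T) := Σ_w (Π_f σ_f[w_f]) · T(w)` — the class functional of the tensor `σ₀ ⊗ σ₁ ⊗ σ₂ ⊗ σ₃`. -/
def tfun (σ : Fin 4 → Fin 6 → GaussianInt) (T : CWord → GaussianInt) : GaussianInt :=
  ∑ w : CWord, (∏ f, σ f (w f)) * T w

/-- on a pure tensor a rank-one functional FACTORS: `Λ_σ(⊗_f v_f) = Π_f ⟨σ_f, v_f⟩` (product of sums = sum over words of products). -/
theorem tfun_chTensor (σ v : Fin 4 → Fin 6 → GaussianInt) : tfun σ (chTensor v) = ∏ f, ∑ l, σ f l * v f l := by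
  unfold tfun
  rw [Fintype.prod_sum]
  refine Finset.sum_congr rfl fun w _ => ?_
  rw [Fin.prod_univ_four, Fin.prod_univ_four]
  simp only [chTensor]
  ring

/-- a rank-one functional on a weighted class tensor, cell by cell (linearity). -/
theorem MConfig.tfun_wch (C : MConfig) (mN mP : MCell → ℤ) (σ : Fin 4 → Fin 6 → GaussianInt) :
    tfun σ (C.wch mN mP) =
      ∑ Z ∈ C.lower, (mN Z : GaussianInt) * tfun σ Z.ch - ∑ P ∈ C.upper, (mP P : GaussianInt) * tfun σ P.ch := by
  have hw : ∀ w, C.wch mN mP w = ∑ Z ∈ C.lower, (mN Z : GaussianInt) * Z.ch w - ∑ P ∈ C.upper, (mP P : GaussianInt) * P.ch w := by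
    intro w
    simp only [MConfig.wch, Pi.sub_apply, Finset.sum_apply, Pi.smul_apply]
    simp only [zsmul_eq_mul]
  simp only [tfun, hw, mul_sub, Finset.sum_sub_distrib, Finset.mul_sum]
  congr 1 <;> (rw [Finset.sum_comm]; exact Finset.sum_congr rfl fun Z _ => Finset.sum_congr rfl fun w _ => by ring)

/-- the letters of `eeee` and `ēēēē`. -/
theorem eWord_apply (f : Fin 4) : eWord f = 3 ∧ ebarWord f = 4 := by
  fin_cases f <;> exact ⟨rfl, rfl⟩

/-- **A RANK-ONE FUNCTIONAL READING ONLY `e, ē` ON SOME FACTOR AND NO `e, ē` ON ANOTHER KILLS EVERY CLASS FUNCTION PASSING (A1)(i)**: its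
support lies in the e-mixed words other than `eeee`, `ēēēē`. -/
theorem tfun_eq_zero_of_classScreen (σ : Fin 4 → Fin 6 → GaussianInt) (f₀ g₀ : Fin 4) (hf : ∀ l : Fin 6, l ≠ 3 → l ≠ 4 → σ f₀ l = 0)
    (hg : σ g₀ 3 = 0 ∧ σ g₀ 4 = 0) (T : CWord → GaussianInt) (h : ClassScreen T) : tfun σ T = 0 := by
  refine Finset.sum_eq_zero fun w _ => ?_
  by_cases h34 : w f₀ = 3 ∨ w f₀ = 4
  · by_cases hg34 : w g₀ = 3 ∨ w g₀ = 4
    · have h0 : σ g₀ (w g₀) = 0 := hg34.elim (fun e => e ▸ hg.1) fun e => e ▸ hg.2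
      rw [Finset.prod_eq_zero (Finset.mem_univ g₀) h0, zero_mul]
    · push Not at hg34
      have hT : T w = 0 := h.1 w (fun hE => h34.elim (hE f₀).1 (hE f₀).2)
        (fun e => hg34.1 (by rw [e]; exact (eWord_apply g₀).1)) fun e => hg34.2 (by rw [e]; exact (eWord_apply g₀).2)
      rw [hT, mul_zero]
  · push Not at h34
    rw [Finset.prod_eq_zero (Finset.mem_univ f₀) (hf _ h34.1 h34.2), zero_mul]

/-! ## §2 The letters: μ₄ points, the two PARITY SELECTORS `e + ē`, `i(e − ē)`, the face reading of a letter -/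

/-- a μ₄ POINT: uncharged (`β = 0`) or an axis letter (`β ∈ {c, −ci, −c, ci}`, `c ≠ 0`) — the `β`-coordinate of every 𝔅(μ₄) letter
(`α` is not constrained here: rays, towers, nodes all qualify). Decidable. -/
abbrev Mu4Pt (x : BPoint) : Prop := x.2 = (0, 0) ∨ AxisPt x

/-- every charged-ray letter `lpt c k` (any `c`, any phase) is a μ₄ point. -/
theorem mu4Pt_lpt (c : ℤ) (k : Fin 4) : Mu4Pt (lpt c k) := by
  by_cases hc : c = 0
  · left; subst hc; fin_cases k <;> simp [lpt, ray]
  · exact Or.inr (axisPt_lpt c hc k)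

/-- the selector of REAL-PHASE charge: coefficient `1` on `e` and on `ē` (reads `β + β̄ = 2 Re β`). -/
def selR : Fin 6 → GaussianInt := ![0, 0, 0, 1, 1, 0]

/-- the selector of IMAGINARY-PHASE charge: `i·e − i·ē` (reads `i(β − β̄) = −2 Im β`). -/
def selI : Fin 6 → GaussianInt := ![0, 0, 0, unitI, -unitI, 0]

/-- the selector of parity bit `b ∈ {0, 1}`. -/
def sel (b : ℕ) : Fin 6 → GaussianInt := if b = 0 then selR else selI

/-- the single-letter reader `δ_l`. -/
def dlt (l : Fin 6) : Fin 6 → GaussianInt := fun l' => if l' = l then 1 else 0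

/-- the FACE READING of a letter at parity bit `b`: its SIGNED charge `chargeOf` if it is charged with phase parity `b`, else `0`
(`chargeOf = Re β − Im β`: `+c` on `c, −ci` and `−c` on `−c, ci` — the antipodal sign of LEMMA FC-CORE §1b ∕ §2's general-phase form). -/
def faceCh (b : ℕ) (x : BPoint) : ℤ := if kbit x = b then chargeOf x else 0

/-- selectors vanish off `e, ē`; readers of e-free letters vanish on `e, ē`. -/
theorem sel_dlt_support (b : ℕ) (l : Fin 6) :
    (l ≠ 3 → l ≠ 4 → sel b l = 0) ∧ (l ≠ 3 → l ≠ 4 → dlt l 3 = 0 ∧ dlt l 4 = 0) := by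
  refine ⟨fun h3 h4 => ?_, fun h3 h4 => ⟨if_neg (Ne.symm h3), if_neg (Ne.symm h4)⟩⟩
  unfold sel
  split_ifs <;> fin_cases l <;> simp_all [selR, selI]

/-- **THE SELECTORS READ THE FACE CHARGE, ×2**: on a μ₄ point, `⟨sel b, φ(x)⟩ = 2 · faceCh b x` (`(e + ē)(c·i^{−k}) = 2c[k even]·(±1)`,
`i(e − ē)(c·i^{−k}) = 2c[k odd]·(±1)`, and `0` on an uncharged letter). -/
theorem sel_bphi (b : ℕ) (hb : b = 0 ∨ b = 1) (x : BPoint) (hx : Mu4Pt x) :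
    ∑ l, sel b l * bphi x l = 2 * (faceCh b x : GaussianInt) := by
  obtain ⟨α, b1, b2⟩ := x
  rw [Fin.sum_univ_succ, Fin.sum_univ_succ, Fin.sum_univ_succ, Fin.sum_univ_succ, Fin.sum_univ_succ, Fin.sum_univ_one]
  rcases hx with h0 | ⟨hb1, hb2⟩ | ⟨hb1, hb2⟩
  · simp only [Prod.mk.injEq] at h0
    obtain ⟨rfl, rfl⟩ := h0
    rcases hb with rfl | rfl <;> simp [sel, selR, selI, bphi, phiVec, faceCh, chargeOf, kbit, Zsqrtd.ext_iff]
  · simp only at hb2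
    subst hb2
    rcases hb with rfl | rfl
    · simp [sel, selR, bphi, phiVec, faceCh, chargeOf, kbit, Zsqrtd.ext_iff]
      ring
    · simp [sel, selI, bphi, phiVec, faceCh, kbit, unitI]
  · simp only at hb1
    subst hb1
    simp only at hb2
    rcases hb with rfl | rfl
    · simp [sel, selR, bphi, phiVec, faceCh, kbit, Zsqrtd.ext_iff, hb2]
    · simp [sel, selI, bphi, phiVec, faceCh, chargeOf, kbit, Zsqrtd.ext_iff, unitI, hb2]
      ring

/-- the reader `δ_l` of an e-free letter reads the INTEGER entry `rphi x l` (`1, α, α, ·, ·, α² − |β|²`). -/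
theorem dlt_bphi (l : Fin 6) (h3 : l ≠ 3) (h4 : l ≠ 4) (x : BPoint) : ∑ l', dlt l l' * bphi x l' = (rphi x l : GaussianInt) := by
  rw [Finset.sum_eq_single l (fun l' _ hl' => by simp [dlt, hl']) (fun h => (h (Finset.mem_univ _)).elim)]
  simp [dlt, bphi_eq_cast x l h3 h4]

/-! ## §3 Faces: the functional of a face word and a parity pattern, its value on a μ₄ cell, FACE BALANCE -/

/-- factor `f` is ON THE FACE of the word `w`: its letter is `e` or `ē` (the set `A = A(w)`; the other factors are FREE and carry the
e-free letter `w_f ∈ {1, u, v, p}` to be read). Decidable. -/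
abbrev OnFace (w : CWord) (f : Fin 4) : Prop := w f = 3 ∨ w f = 4

/-- the FACE FUNCTIONAL of a face word `w` and a parity pattern `ρ` (bits `bitOf ρ f`, read on the face only): parity selector on the
face, letter reader off it. -/
def faceFun (w : CWord) (ρ : Fin 16) : Fin 4 → Fin 6 → GaussianInt :=
  fun f => if OnFace w f then sel (bitOf ρ f) else dlt (w f)

/-- the FACE WEIGHT of a cell: `Π_{f ∈ A} faceCh_{ρ_f}(Z_f) · Π_{g ∉ A} rphi(Z_g)[w_g]` — non-zero only if `Z` is charged on all of `A` with
parity pattern `ρ_A` there (the face group `G(A, ρ_A)`), and then `= (signed Π_{f∈A} c_f) · Π_{g ∉ A} φ(x_g)[w_g]` (LEMMA FC-CORE §2's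
`W_Z · Π_g φ(x_g)[w_g]` with the antipodal sign). An integer. -/
def MCell.faceWt (w : CWord) (ρ : Fin 16) (Z : MCell) : ℤ :=
  ∏ f, if OnFace w f then faceCh (bitOf ρ f) (Z f) else rphi (Z f) (w f)

/-- the number of face factors, as the power of two `2^{|A|} = Π_f (2 if f ∈ A else 1)`. -/
def faceTwo (w : CWord) : GaussianInt := ∏ f : Fin 4, if OnFace w f then (2 : GaussianInt) else 1

/-- `2^{|A|} ≠ 0` in `ℤ[i]`. -/
theorem faceTwo_ne_zero (w : CWord) : faceTwo w ≠ 0 :=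
  Finset.prod_ne_zero_iff.2 fun f _ => by split_ifs <;> decide

/-- a pattern bit is `0` or `1`. -/
theorem bitOf_le (ρ : Fin 16) (f : Fin 4) : bitOf ρ f = 0 ∨ bitOf ρ f = 1 := by
  unfold bitOf; omega

/-- **THE FACE FUNCTIONAL READS THE FACE WEIGHT, ×2^{|A|}**, on every cell whose face letters are μ₄ points. -/
theorem MCell.tfun_faceFun (w : CWord) (ρ : Fin 16) (Z : MCell) (hZ : ∀ f, OnFace w f → Mu4Pt (Z f)) :
    tfun (faceFun w ρ) Z.ch = faceTwo w * (Z.faceWt w ρ : GaussianInt) := by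
  rw [MCell.ch, tfun_chTensor, MCell.faceWt, faceTwo, Int.cast_prod, ← Finset.prod_mul_distrib]
  refine Finset.prod_congr rfl fun f _ => ?_
  by_cases hf : OnFace w f
  · simp only [faceFun, hf, if_true, sel_bphi _ (bitOf_le ρ f) _ (hZ f hf)]
  · have h34 : w f ≠ 3 ∧ w f ≠ 4 := by simpa [OnFace, not_or] using hf
    simp only [faceFun, hf, if_false, dlt_bphi _ h34.1 h34.2, one_mul]

/-- **THE FACE FUNCTIONAL KILLS (A1)**: if the face is non-empty (`f₀`) and proper (`g₀` free), `Λ_{face}(T) = 0` for every `T` passing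
the class screen — its words carry `e ∕ ē` on `f₀` and an e-free letter on `g₀`. -/
theorem faceFun_eq_zero_of_classScreen (w : CWord) (ρ : Fin 16) (f₀ g₀ : Fin 4) (hf : OnFace w f₀) (hg : ¬ OnFace w g₀)
    (T : CWord → GaussianInt) (h : ClassScreen T) : tfun (faceFun w ρ) T = 0 := by
  have h34 : w g₀ ≠ 3 ∧ w g₀ ≠ 4 := by simpa [OnFace, not_or] using hg
  refine tfun_eq_zero_of_classScreen _ f₀ g₀ (fun l h3 h4 => ?_) ?_ T h
  · simp only [faceFun, hf, if_true, (sel_dlt_support _ l).1 h3 h4]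
  · simp only [faceFun, hg, if_false]
    exact ((sel_dlt_support 0 (w g₀)).2 h34.1 h34.2)

/-- **FACE BALANCE (LEMMA FC-CORE §2, general-phase form, all of 𝔅(μ₄)).** For every weighted configuration whose cells' face letters are
μ₄ points, every face word `w` with a non-empty proper face `A(w)` (letters `e ∕ ē` on `A`, e-free letters off `A`) and every parity
pattern `ρ`: if the weighted class tensor passes the class screen (A1), then
`Σ_{N ∈ E₋} m_N · faceWt(N) = Σ_{P ∈ E₊} m_P · faceWt(P)` — the signed-charge-weighted `w`-moment of the face group `G(A, ρ_A)` is
level-balanced. (`8 + 24 + 32 = 64` face groups `(A, ρ_A)`; moments `w_g ∈ {1, u, v, p}` per free factor; μ not involved.) -/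
theorem MConfig.faceBalance_of_classScreen (C : MConfig) (mN mP : MCell → ℤ)
    (hN : ∀ Z ∈ C.lower, ∀ f, Mu4Pt (Z f)) (hP : ∀ P ∈ C.upper, ∀ f, Mu4Pt (P f))
    (w : CWord) (ρ : Fin 16) (f₀ g₀ : Fin 4) (hf : OnFace w f₀) (hg : ¬ OnFace w g₀) (h : ClassScreen (C.wch mN mP)) :
    ∑ Z ∈ C.lower, mN Z * Z.faceWt w ρ = ∑ P ∈ C.upper, mP P * P.faceWt w ρ := by
  have h0 := faceFun_eq_zero_of_classScreen w ρ f₀ g₀ hf hg _ h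
  have hl : ∑ Z ∈ C.lower, (mN Z : GaussianInt) * tfun (faceFun w ρ) Z.ch =
      ∑ Z ∈ C.lower, (mN Z : GaussianInt) * (faceTwo w * (Z.faceWt w ρ : GaussianInt)) :=
    Finset.sum_congr rfl fun Z hZ => by rw [MCell.tfun_faceFun w ρ Z fun f _ => hN Z hZ f]
  have hu : ∑ P ∈ C.upper, (mP P : GaussianInt) * tfun (faceFun w ρ) P.ch =
      ∑ P ∈ C.upper, (mP P : GaussianInt) * (faceTwo w * (P.faceWt w ρ : GaussianInt)) :=
    Finset.sum_congr rfl fun P hP' => by rw [MCell.tfun_faceFun w ρ P fun f _ => hP P hP' f]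
  rw [MConfig.tfun_wch, hl, hu] at h0
  have h1 : faceTwo w * ((∑ Z ∈ C.lower, mN Z * Z.faceWt w ρ - ∑ P ∈ C.upper, mP P * P.faceWt w ρ : ℤ) : GaussianInt) = 0 := by
    rw [← h0]
    push_cast
    rw [mul_sub, Finset.mul_sum, Finset.mul_sum]
    congr 1 <;> exact Finset.sum_congr rfl fun _ _ => by ring
  have h2 := (mul_eq_zero.1 h1).resolve_left (faceTwo_ne_zero w)
  exact sub_eq_zero.1 (by exact_mod_cast h2)

/-! ## §4 Presence forms for the encoder: signs on a face group (all phases), level balance (window phases); face words; probes -/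

/-- a BALANCE OF POSITIVELY WEIGHTED SUMS FORCES MIXED SIGNS: if `Σ_S a·x = Σ_T b·x` with `a, b > 0`, a positive `x` on `S` or a negative
`x` on `T` is matched by a negative `x` on `S` or a positive `x` on `T`. -/
theorem balance_signs {ι : Type*} (S T : Finset ι) (a b x : ι → ℤ) (ha : ∀ i ∈ S, 0 < a i) (hb : ∀ j ∈ T, 0 < b j)
    (h : ∑ i ∈ S, a i * x i = ∑ j ∈ T, b j * x j) :
    ((∃ i ∈ S, 0 < x i) ∨ ∃ j ∈ T, x j < 0) → (∃ i ∈ S, x i < 0) ∨ ∃ j ∈ T, 0 < x j := by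
  intro hyp
  by_contra hcon
  push Not at hcon
  obtain ⟨hS, hT⟩ := hcon
  have hS' : ∀ i ∈ S, 0 ≤ a i * x i := fun i hi => mul_nonneg (ha i hi).le (hS i hi)
  have hT' : ∀ j ∈ T, b j * x j ≤ 0 := fun j hj => mul_nonpos_of_nonneg_of_nonpos (hb j hj).le (hT j hj)
  have h0S : ∑ i ∈ S, a i * x i = 0 :=
    le_antisymm (h ▸ Finset.sum_nonpos hT') (Finset.sum_nonneg hS')
  have h0T : ∑ j ∈ T, b j * x j = 0 := h ▸ h0S
  rcases hyp with ⟨i, hi, hx⟩ | ⟨j, hj, hx⟩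
  · have := (Finset.sum_eq_zero_iff_of_nonneg hS').1 h0S i hi
    rcases mul_eq_zero.1 this with h1 | h1
    · exact absurd h1 (ha i hi).ne'
    · omega
  · have := (Finset.sum_eq_zero_iff_of_nonpos hT').1 h0T j hj
    rcases mul_eq_zero.1 this with h1 | h1
    · exact absurd h1 (hb j hj).ne'
    · omega

/-- **(M0)–(M2), PRESENCE FORM WITH SIGNS (all of 𝔅(μ₄))**: with positive multiplicities, under (A1) the face weight `faceWt` of a non-empty
proper face is never ONE-SIGNED against the levels: a lower cell with positive face weight or an upper cell with negative one is matched by a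
lower cell with negative or an upper cell with positive face weight — and conversely. (For the pure face word, §4 below, the face weight is
the signed A-charge `Π_{f∈A} chargeOf`, so: on a face group met by the support the sign `ε_Z · sign Π_{f∈A} chargeOf(Z_f)` is NOT constant —
LEMMA FC-CORE §5's general-phase presence form; for `w_g = u, p` the same for the moments `α_g`, `α_g² − |β_g|²`: (M1), (M2).) -/
theorem MConfig.faceSigns_of_classScreen (C : MConfig) (mN mP : MCell → ℤ)
    (hN : ∀ Z ∈ C.lower, ∀ f, Mu4Pt (Z f)) (hP : ∀ P ∈ C.upper, ∀ f, Mu4Pt (P f))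
    (hmN : ∀ Z ∈ C.lower, 0 < mN Z) (hmP : ∀ P ∈ C.upper, 0 < mP P)
    (w : CWord) (ρ : Fin 16) (f₀ g₀ : Fin 4) (hf : OnFace w f₀) (hg : ¬ OnFace w g₀) (h : ClassScreen (C.wch mN mP)) :
    ((∃ Z ∈ C.lower, 0 < Z.faceWt w ρ) ∨ ∃ P ∈ C.upper, P.faceWt w ρ < 0) ↔
      (∃ Z ∈ C.lower, Z.faceWt w ρ < 0) ∨ ∃ P ∈ C.upper, 0 < P.faceWt w ρ := by
  have hb := C.faceBalance_of_classScreen mN mP hN hP w ρ f₀ g₀ hf hg h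
  refine ⟨balance_signs _ _ _ _ _ hmN hmP hb, fun hyp => ?_⟩
  exact (balance_signs _ _ _ _ _ hmP hmN hb.symm (Or.comm.1 hyp)).symm

/-- a PURE face word: `e ∕ ē` on the face, the letter `1` elsewhere; then the face weight is the signed A-charge
`Π_{f ∈ A} faceCh_{ρ_f}(Z_f)` alone (no free-factor moment). -/
abbrev PureFace (w : CWord) : Prop := ∀ f, OnFace w f ∨ w f = 0

/-- at a pure face word the face weight is the signed A-charge `Π_{f ∈ A} faceCh_{ρ_f}(Z_f)` (free factors read `1`). -/
theorem MCell.faceWt_pure (w : CWord) (hw : PureFace w) (ρ : Fin 16) (Z : MCell) :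
    Z.faceWt w ρ = ∏ f, if OnFace w f then faceCh (bitOf ρ f) (Z f) else 1 := by
  refine Finset.prod_congr rfl fun f _ => ?_
  by_cases h : OnFace w f
  · simp [h]
  · have h0 : w f = 0 := (hw f).resolve_left h
    simp [h, h0, rphi, phiVec]

/-- a cell LIES IN THE FACE GROUP `G(A, ρ_A)`: charged on every face factor, with the prescribed phase parity there. Decidable. -/
abbrev MCell.InFace (w : CWord) (ρ : Fin 16) (Z : MCell) : Prop := ∀ f, OnFace w f → (Z f).2 ≠ (0, 0) ∧ kbit (Z f) = bitOf ρ f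

/-- on a μ₄ point the face reading is non-zero iff the letter is charged with the prescribed parity; on a WINDOW-or-zero point
(`β ∈ {0, c, −ci}`, `c > 0` — the two-phase alphabet `𝒜_{1,i}` of LEMMA FC-CORE §2) it is moreover `≥ 0`. -/
theorem faceCh_ne_zero_iff (b : ℕ) (x : BPoint) (hx : Mu4Pt x) : faceCh b x ≠ 0 ↔ x.2 ≠ (0, 0) ∧ kbit x = b := by
  obtain ⟨α, b1, b2⟩ := x
  rcases hx with h0 | ⟨hb1, hb2⟩ | ⟨hb1, hb2⟩
  · simp only [Prod.mk.injEq] at h0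
    obtain ⟨rfl, rfl⟩ := h0
    simp [faceCh, chargeOf]
  · simp only at hb1 hb2
    subst hb2
    by_cases hb : (0 : ℕ) = b <;> simp [faceCh, chargeOf, kbit, hb, hb1]
  · simp only at hb1 hb2
    subst hb1
    by_cases hb : (1 : ℕ) = b <;> simp [faceCh, chargeOf, kbit, hb, hb2]

/-- on a window-or-zero point the face reading is `≥ 0` (`chargeOf = c > 0` on `c, −ci`). -/
theorem faceCh_nonneg_win (b : ℕ) (x : BPoint) (hx : x.2 = (0, 0) ∨ WinPt x) : 0 ≤ faceCh b x := by
  obtain ⟨α, b1, b2⟩ := x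
  have hc : 0 ≤ b1 - b2 := by
    rcases hx with h0 | ⟨hb1, hb2⟩ | ⟨hb1, hb2⟩
    · simp only [Prod.mk.injEq] at h0
      omega
    · simp only at hb1 hb2
      omega
    · simp only at hb1 hb2
      omega
  unfold faceCh chargeOf
  split_ifs
  exacts [hc, le_rfl]

/-- on a μ₄ cell the PURE face weight is non-zero iff the cell lies in the face group. -/
theorem MCell.faceWt_pure_ne_zero_iff (w : CWord) (hw : PureFace w) (ρ : Fin 16) (Z : MCell) (hZ : ∀ f, Mu4Pt (Z f)) :
    Z.faceWt w ρ ≠ 0 ↔ Z.InFace w ρ := by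
  rw [Z.faceWt_pure w hw ρ, Finset.prod_ne_zero_iff]
  refine ⟨fun H f hf => ?_, fun H f _ => ?_⟩
  · have := H f (Finset.mem_univ f)
    rw [if_pos hf] at this
    exact (faceCh_ne_zero_iff _ _ (hZ f)).1 this
  · by_cases hf : OnFace w f
    · rw [if_pos hf]; exact (faceCh_ne_zero_iff _ _ (hZ f)).2 (H f hf)
    · rw [if_neg hf]; exact one_ne_zero

/-- **(M0) AS PRINTED, FOR THE TWO-PHASE WINDOW `𝒜_{1,i}` (the encoder's clause (R2))**: with positive multiplicities and window-or-zero
letters, under (A1) every face group `G(A, ρ_A)` (`A` non-empty proper) that meets the support meets BOTH levels — it contains an N-class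
iff it contains a P-class. (With window letters the signed A-charge is `> 0` on the group, so «signs not constant» becomes «both levels».) -/
theorem MConfig.faceGroup_bothLevels_win (C : MConfig) (mN mP : MCell → ℤ)
    (hN : ∀ Z ∈ C.lower, ∀ f, (Z f).2 = (0, 0) ∨ WinPt (Z f)) (hP : ∀ P ∈ C.upper, ∀ f, (P f).2 = (0, 0) ∨ WinPt (P f))
    (hmN : ∀ Z ∈ C.lower, 0 < mN Z) (hmP : ∀ P ∈ C.upper, 0 < mP P)
    (w : CWord) (hw : PureFace w) (ρ : Fin 16) (f₀ g₀ : Fin 4) (hf : OnFace w f₀) (hg : ¬ OnFace w g₀)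
    (h : ClassScreen (C.wch mN mP)) :
    (∃ Z ∈ C.lower, Z.InFace w ρ) ↔ ∃ P ∈ C.upper, P.InFace w ρ := by
  have mu4 : ∀ x : BPoint, x.2 = (0, 0) ∨ WinPt x → Mu4Pt x := fun x hx => hx.imp id WinPt.axisPt
  have hN' : ∀ Z ∈ C.lower, ∀ f, Mu4Pt (Z f) := fun Z hZ f => mu4 _ (hN Z hZ f)
  have hP' : ∀ P ∈ C.upper, ∀ f, Mu4Pt (P f) := fun P hP'' f => mu4 _ (hP P hP'' f)
  have nn : ∀ Z : MCell, (∀ f, (Z f).2 = (0, 0) ∨ WinPt (Z f)) → 0 ≤ Z.faceWt w ρ := fun Z hZ => by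
    rw [Z.faceWt_pure w hw ρ]
    exact Finset.prod_nonneg fun f _ => by split_ifs; exacts [faceCh_nonneg_win _ _ (hZ f), zero_le_one]
  have key := C.faceSigns_of_classScreen mN mP hN' hP' hmN hmP w ρ f₀ g₀ hf hg h
  constructor
  · rintro ⟨Z, hZ, hin⟩
    have hpos : 0 < Z.faceWt w ρ :=
      lt_of_le_of_ne (nn Z (hN Z hZ)) ((Z.faceWt_pure_ne_zero_iff w hw ρ (hN' Z hZ)).2 hin).symm
    rcases key.1 (Or.inl ⟨Z, hZ, hpos⟩) with ⟨Z', hZ', hneg⟩ | ⟨P, hPu, hpos'⟩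
    · exact absurd hneg (not_lt.2 (nn Z' (hN Z' hZ')))
    · exact ⟨P, hPu, (P.faceWt_pure_ne_zero_iff w hw ρ (hP' P hPu)).1 hpos'.ne'⟩
  · rintro ⟨P, hPu, hin⟩
    have hpos : 0 < P.faceWt w ρ :=
      lt_of_le_of_ne (nn P (hP P hPu)) ((P.faceWt_pure_ne_zero_iff w hw ρ (hP' P hPu)).2 hin).symm
    rcases key.2 (Or.inr ⟨P, hPu, hpos⟩) with ⟨Z, hZ, hpos'⟩ | ⟨P', hP'', hneg⟩
    · exact ⟨Z, hZ, (Z.faceWt_pure_ne_zero_iff w hw ρ (hN' Z hZ)).1 hpos'.ne'⟩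
    · exact absurd hneg (not_lt.2 (nn P' (hP P' hP'')))

/-- THE COUNT OF FACE GROUPS: over the `14` non-empty proper faces `A`, `Σ_A 2^{|A|} = 4·2 + 6·4 + 4·8 = 64` groups `(A, ρ_A)`
(LEMMA FC-CORE §2: «|A| = 1: 8; |A| = 2: 24; |A| = 3: 32»). [`decide`] -/
theorem faceGroup_count :
    ∑ A ∈ (Finset.univ : Finset (Finset (Fin 4))).filter (fun A => A ≠ ∅ ∧ A ≠ Finset.univ), 2 ^ A.card = 64 ∧
    ∑ A ∈ (Finset.univ : Finset (Finset (Fin 4))).filter (fun A => A.card = 1), 2 ^ A.card = 8 ∧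
    ∑ A ∈ (Finset.univ : Finset (Finset (Fin 4))).filter (fun A => A.card = 2), 2 ^ A.card = 24 ∧
    ∑ A ∈ (Finset.univ : Finset (Finset (Fin 4))).filter (fun A => A.card = 3), 2 ^ A.card = 32 := by
  decide

/-! ## §5 Probes (`decide` ∕ `rfl` on closed terms) -/

/-- PROBE (`decide`) on the cell `Z = [2·ℓ_i | (3,0,0) | (1,0,0) | ℓ₁]` (factor 0: `β = 2i`, an imaginary-phase letter with `kbit = 1` and
signed charge `chargeOf = −2` — the antipodal sign of `ci`; factor 3: `β = 1`, `kbit = 0`, `chargeOf = 1`): for the face word `e u 1 1` (face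
`A = {0}`) `Z` lies in the group `ρ_0 = 1` (pattern index `8`), not in `ρ_0 = 0`, with face weights `(−2)·α_1·1·1 = −6` resp. `0`; with the free
letter `p` on factor 3 the moment vanishes (`α² − |β|² = 0` there); for the face word `ē 1 1 e` (face `{0, 3}`) the weight is `0` at `ρ = 1001`
(factor 3 is real-phase) and `(−2)·1 = −2` at `ρ = 1000`. -/
theorem face_probe :
    let Z : MCell := ![lpt 2 3, (3, 0, 0), (1, 0, 0), lpt 1 0]
    Z.InFace ![3, 1, 0, 0] 8 ∧ ¬ Z.InFace ![3, 1, 0, 0] 0 ∧ Z.faceWt ![3, 1, 0, 0] 8 = -6 ∧ Z.faceWt ![3, 1, 0, 0] 0 = 0 ∧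
      Z.faceWt ![3, 1, 0, 5] 8 = 0 ∧ Z.faceWt ![4, 0, 0, 3] 9 = 0 ∧ Z.faceWt ![4, 0, 0, 3] 8 = -2 := by
  decide

end Summit.Ventures.HSemireg.Pad4Tower
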